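import Summits.MatrixMultiplication.OmegaCensus.BoxBadSmallGroups2

/-!
# ω-census, family (b3): conjecture C9 on the dihedral family — the uniform construction: `D_{2n}` is not box-useful for every `n ≥ 35`

HONEST FRAMING (pub-omega census; verbatim): lottery ticket; floor = certified bounds/negative ranges.
Census BOOKKEEPING (conjecture C9 of the cell; pub-omega stpp-1 gen 18).  THE CONSTRUCTION (uniform in `n`): in `D_{2n}`
take the box `Y = {1, r, s}`, `W = {1, r², s}` and the eight columns `(y, w) ∈ {A = (1,1), B = (1,r²), C = (r,1), D = (r,r²),
E = (s,s), F = (1,s), H = (s,1), J = (s,r²)}`; the 'fibre-0' cell of column `c` at exponent `i` is `(r^i, y, w)` for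
`A…E` and `(s r^i, y, w)` for `F, H, J`, the 'fibre-1' cell is the same with `x` replaced by `x s`.  The word of two such cells
is a REFLECTION (never `1`) across fibres, and inside a fibre a ROTATION `r^{±(i − i') + k}` with `|k| ≤ 3` given by an
explicit `256`-entry table (`WT`, derived from the group law; `cellWord_cell`).  Using, at the exponents `i < n − 3` with
`i mod 8` in the column pattern `A:{6,7} B:{0,1} C:{0,7} D:{1,2} E:{4,5} F:{2,3} H:{0,1} J:{6,7}` (an `8`-periodic pattern of
density `2` on which no two cells at exponent distance `≤ 3` have a forbidden difference — a finite check mod `8`), every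
congruence `±(i − i') + k ≡ 0 (mod n)` is an integer equality (`|i − i'| ≤ n − 4`), so the cell set is independent; it has
`2 · (16 ⌊(n−3)/8⌋ + pre(n−3 mod 8)) ≥ 4n − 14` cells, which is `≥ (9/5) · 2n` exactly when `n ≥ 35`.  Hence
`not_boxUseful_dihedral_of_le : 35 ≤ n → ¬ BoxUseful (DihedralGroup n)` (this file, which imports only the lifting toolkit);
with `BoxUsefulDihedral` (every `5 ≤ n ≤ 34`, `n ≠ 6`, has a divisor among `5,7,8,9,11,12,13,17,19,23,29,31`; `n = 1,2,3,4,6`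
are useful) the CLASSIFICATION `BoxUseful (DihedralGroup n) ↔ n ∈ {1,2,3,4,6}` for every `n ≥ 1` follows in two lines — it is
assembled in the companion file `DihedralClassification.lean` (conjecture C9 (b) on the whole dihedral family: the useful
members are exactly the abelian / centre-index-`4` / centre-index-`6` ones).  Construction found and verified literally on Cayley
tables for `n = 9 … 47, 64` by stpp-1 g18 (`code/dih/`).  Nothing here is progress on `ω`.
-/

namespace Summit.MatrixMultiplication.OmegaCensus

open Finset ProductBoxBound DihedralGroup

namespace DihedralUniform

variable {n : ℕ}

/-- `y`-coordinate of column `c` (`A B C D E F H J` = `0 … 7`). [folklore] -/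
def yOf (c : Fin 8) : DihedralGroup n := ![r 0, r 0, r 1, r 1, sr 0, r 0, sr 0, sr 0] c

/-- `w`-coordinate of column `c`. [folklore] -/
def wOf (c : Fin 8) : DihedralGroup n := ![r 0, r 2, r 0, r 2, sr 0, sr 0, r 0, r 2] c

/-- Parity of the column: `true` for `F, H, J` (their fibre-0 cells have a reflection as `x`). [folklore] -/
def par (c : Fin 8) : Bool := ![false, false, false, false, false, true, true, true] c

/-- `x`-coordinate of the fibre-`b` cell of column `c` at exponent `i` (fibre 1 = fibre 0 times `s` on the right). [folklore] -/
def xOf (b : Bool) (c : Fin 8) (i : ZMod n) : DihedralGroup n :=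
  if par c then (if b then r (-i) else sr i) else (if b then sr (-i) else r i)

/-- The cell of fibre `b`, column `c`, exponent `i`. [folklore] -/
def cell (b : Bool) (c : Fin 8) (i : ZMod n) : DihedralGroup n × DihedralGroup n × DihedralGroup n :=
  (xOf b c i, yOf c, wOf c)

/-- Word table, fibre `0` against fibre `0`: `(isReflection, sign, constant)`. [folklore] -/
def T00 : Fin 8 → Fin 8 → Bool × ℤ × ℤ :=
  ![![(false, 1, 0), (false, 1, -2), (false, 1, -1), (false, 1, -3), (false, 1, 0), (false, 1, 0), (false, 1, 0), (false, 1, -2)],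
    ![(false, 1, 2), (false, 1, 0), (false, 1, 1), (false, 1, -1), (false, 1, -2), (false, 1, -2), (false, 1, 2), (false, 1, 0)],
    ![(false, 1, 1), (false, 1, -1), (false, 1, 0), (false, 1, -2), (false, 1, 1), (false, 1, -1), (false, 1, -1), (false, 1, -3)],
    ![(false, 1, 3), (false, 1, 1), (false, 1, 2), (false, 1, 0), (false, 1, -1), (false, 1, -3), (false, 1, 1), (false, 1, -1)],
    ![(false, 1, 0), (false, 1, -2), (false, 1, 1), (false, 1, -1), (false, 1, 0), (false, 1, 0), (false, 1, 0), (false, 1, -2)],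
    ![(false, -1, 0), (false, -1, -2), (false, -1, 1), (false, -1, -1), (false, -1, 0), (false, -1, 0), (false, -1, 0), (false, -1, -2)],
    ![(false, -1, 0), (false, -1, -2), (false, -1, -1), (false, -1, -3), (false, -1, 0), (false, -1, 0), (false, -1, 0), (false, -1, -2)],
    ![(false, -1, 2), (false, -1, 0), (false, -1, 1), (false, -1, -1), (false, -1, -2), (false, -1, -2), (false, -1, 2), (false, -1, 0)]]

/-- Word table, fibre `0` against fibre `1`. [folklore] -/
def T01 : Fin 8 → Fin 8 → Bool × ℤ × ℤ :=
  ![![(true, 0, 0), (true, 0, 0), (true, 0, 0), (true, 0, 0), (true, 0, 0), (true, 0, 0), (true, 0, 0), (true, 0, 0)],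
    ![(true, 0, 0), (true, 0, 0), (true, 0, 0), (true, 0, 0), (true, 0, 0), (true, 0, 0), (true, 0, 0), (true, 0, 0)],
    ![(true, 0, 0), (true, 0, 0), (true, 0, 0), (true, 0, 0), (true, 0, 0), (true, 0, 0), (true, 0, 0), (true, 0, 0)],
    ![(true, 0, 0), (true, 0, 0), (true, 0, 0), (true, 0, 0), (true, 0, 0), (true, 0, 0), (true, 0, 0), (true, 0, 0)],
    ![(true, 0, 0), (true, 0, 0), (true, 0, 0), (true, 0, 0), (true, 0, 0), (true, 0, 0), (true, 0, 0), (true, 0, 0)],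
    ![(true, 0, 0), (true, 0, 0), (true, 0, 0), (true, 0, 0), (true, 0, 0), (true, 0, 0), (true, 0, 0), (true, 0, 0)],
    ![(true, 0, 0), (true, 0, 0), (true, 0, 0), (true, 0, 0), (true, 0, 0), (true, 0, 0), (true, 0, 0), (true, 0, 0)],
    ![(true, 0, 0), (true, 0, 0), (true, 0, 0), (true, 0, 0), (true, 0, 0), (true, 0, 0), (true, 0, 0), (true, 0, 0)]]

/-- Word table, fibre `1` against fibre `0`. [folklore] -/
def T10 : Fin 8 → Fin 8 → Bool × ℤ × ℤ :=
  ![![(true, 0, 0), (true, 0, 0), (true, 0, 0), (true, 0, 0), (true, 0, 0), (true, 0, 0), (true, 0, 0), (true, 0, 0)],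
    ![(true, 0, 0), (true, 0, 0), (true, 0, 0), (true, 0, 0), (true, 0, 0), (true, 0, 0), (true, 0, 0), (true, 0, 0)],
    ![(true, 0, 0), (true, 0, 0), (true, 0, 0), (true, 0, 0), (true, 0, 0), (true, 0, 0), (true, 0, 0), (true, 0, 0)],
    ![(true, 0, 0), (true, 0, 0), (true, 0, 0), (true, 0, 0), (true, 0, 0), (true, 0, 0), (true, 0, 0), (true, 0, 0)],
    ![(true, 0, 0), (true, 0, 0), (true, 0, 0), (true, 0, 0), (true, 0, 0), (true, 0, 0), (true, 0, 0), (true, 0, 0)],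
    ![(true, 0, 0), (true, 0, 0), (true, 0, 0), (true, 0, 0), (true, 0, 0), (true, 0, 0), (true, 0, 0), (true, 0, 0)],
    ![(true, 0, 0), (true, 0, 0), (true, 0, 0), (true, 0, 0), (true, 0, 0), (true, 0, 0), (true, 0, 0), (true, 0, 0)],
    ![(true, 0, 0), (true, 0, 0), (true, 0, 0), (true, 0, 0), (true, 0, 0), (true, 0, 0), (true, 0, 0), (true, 0, 0)]]

/-- Word table, fibre `1` against fibre `1`. [folklore] -/
def T11 : Fin 8 → Fin 8 → Bool × ℤ × ℤ :=
  ![![(false, 1, 0), (false, 1, -2), (false, 1, -1), (false, 1, -3), (false, 1, 0), (false, 1, 0), (false, 1, 0), (false, 1, -2)],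
    ![(false, 1, 2), (false, 1, 0), (false, 1, 1), (false, 1, -1), (false, 1, -2), (false, 1, -2), (false, 1, 2), (false, 1, 0)],
    ![(false, 1, 1), (false, 1, -1), (false, 1, 0), (false, 1, -2), (false, 1, 1), (false, 1, -1), (false, 1, -1), (false, 1, -3)],
    ![(false, 1, 3), (false, 1, 1), (false, 1, 2), (false, 1, 0), (false, 1, -1), (false, 1, -3), (false, 1, 1), (false, 1, -1)],
    ![(false, 1, 0), (false, 1, -2), (false, 1, 1), (false, 1, -1), (false, 1, 0), (false, 1, 0), (false, 1, 0), (false, 1, -2)],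
    ![(false, -1, 0), (false, -1, -2), (false, -1, 1), (false, -1, -1), (false, -1, 0), (false, -1, 0), (false, -1, 0), (false, -1, -2)],
    ![(false, -1, 0), (false, -1, -2), (false, -1, -1), (false, -1, -3), (false, -1, 0), (false, -1, 0), (false, -1, 0), (false, -1, -2)],
    ![(false, -1, 2), (false, -1, 0), (false, -1, 1), (false, -1, -1), (false, -1, -2), (false, -1, -2), (false, -1, 2), (false, -1, 0)]]

/-- The word table `WT b c b' c' = (ρ, α, k)`: the word of the cells `(b,c,i)`, `(b',c',i')` is a reflection if `ρ`, else
`r (α (i − i') + k)`. [folklore] -/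
def WT (b : Bool) (c : Fin 8) (b' : Bool) (c' : Fin 8) : Bool × ℤ × ℤ :=
  if b then (if b' then T11 c c' else T10 c c') else (if b' then T01 c c' else T00 c c')

/-- `r i = 1 ↔ i = 0`. [folklore] -/
theorem r_eq_one_iff (i : ZMod n) : (r i : DihedralGroup n) = 1 ↔ i = 0 := by
  rw [one_def, r.injEq]

/-- A reflection is never `1`. [folklore] -/
theorem sr_eq_one_iff (i : ZMod n) : (sr i : DihedralGroup n) = 1 ↔ False := by
  rw [one_def]; exact ⟨fun h => (by cases h), False.elim⟩

set_option maxHeartbeats 4000000 in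
/-- **The word of two cells** (all `256` fibre/column combinations, from the group law): it is `1` iff the table entry is a
rotation and `α (i − i') + k = 0` in `ℤ/n`. [folklore] -/
theorem cellWord_cell_eq_one (b b' : Bool) (c c' : Fin 8) (i i' : ZMod n) :
    cellWord (cell b c i) (cell b' c' i') = 1 ↔
      (WT b c b' c').1 = false ∧ ((WT b c b' c').2.1 : ZMod n) * (i - i') + ((WT b c b' c').2.2 : ZMod n) = 0 := by
  cases b <;> cases b' <;> fin_cases c <;> fin_cases c' <;>
    simp [cellWord, cell, xOf, yOf, wOf, par, WT, T00, T01, T10, T11, r_eq_one_iff, sr_eq_one_iff] <;>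
    (constructor <;> intro h <;> linear_combination h)

/-! ### The pattern, the forced difference, and the finite checks -/

/-- The 8-periodic column pattern: column `c` is occupied at the exponents `i` with `i mod 8` in `A:{6,7} B:{0,1} C:{0,7}
D:{1,2} E:{4,5} F:{2,3} H:{0,1} J:{6,7}`. [folklore] -/
def pat (c : Fin 8) (m : ℕ) : Bool :=
  ![m == 6 || m == 7, m == 0 || m == 1, m == 0 || m == 7, m == 1 || m == 2, m == 4 || m == 5, m == 2 || m == 3,
    m == 0 || m == 1, m == 6 || m == 7] c

/-- The exponent difference `i − i'` forced by `α (i − i') + k = 0`: `−α k`. [folklore] -/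
def fd (b : Bool) (c : Fin 8) (b' : Bool) (c' : Fin 8) : ℤ := -((WT b c b' c').2.1 * (WT b c b' c').2.2)

/-- Every rotation entry of the word table has sign `±1` and constant `|k| ≤ 3`. [folklore] -/
theorem WT_shape : ∀ (b b' : Bool) (c c' : Fin 8), (WT b c b' c').1 = false →
    ((WT b c b' c').2.1 = 1 ∨ (WT b c b' c').2.1 = -1) ∧ -3 ≤ (WT b c b' c').2.2 ∧ (WT b c b' c').2.2 ≤ 3 := by
  decide +kernel

set_option maxHeartbeats 4000000 in
/-- **The finite check behind the construction** (mod `8`): two occupied cells whose exponents differ by the forced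
difference of their column pair (mod `8`) are the same cell. [folklore] -/
theorem pattern_check : ∀ (b b' : Bool) (c c' : Fin 8) (o o' : Fin 8), (WT b c b' c').1 = false →
    pat c o.val = true → pat c' o'.val = true → ((o.val : ℤ) - o'.val - fd b c b' c') % 8 = 0 →
    b = b' ∧ c = c' ∧ fd b c b' c' = 0 := by
  decide +kernel

/-- A congruence `α (i − i') + k ≡ 0 (mod n)` with `α = ±1`, `|k| ≤ 3` and `i, i' ≤ n − 4` is an equality of integers. [folklore] -/
theorem int_eq_of_zmod_eq {i i' : ℕ} {α k : ℤ} (hα : α = 1 ∨ α = -1) (hk : -3 ≤ k ∧ k ≤ 3) (hi : i + 4 ≤ n)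
    (hi' : i' + 4 ≤ n) (h : (α : ZMod n) * ((i : ZMod n) - (i' : ZMod n)) + (k : ZMod n) = 0) :
    α * ((i : ℤ) - i') + k = 0 := by
  have hz : (((α * ((i : ℤ) - i') + k : ℤ)) : ZMod n) = 0 := by
    push_cast; exact h
  have hdvd : (n : ℤ) ∣ α * ((i : ℤ) - i') + k := (ZMod.intCast_zmod_eq_zero_iff_dvd _ n).1 hz
  refine Int.eq_zero_of_abs_lt_dvd hdvd ?_
  rw [abs_lt]
  rcases hα with rfl | rfl <;> constructor <;> omega

/-! ### The cell set and its independence -/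

variable (n) in
/-- The index set: fibre bit, column, exponent `i < n − 3` in the pattern. [folklore] -/
def idx : Finset (Bool × Fin 8 × ℕ) :=
  (univ : Finset Bool) ×ˢ (((univ : Finset (Fin 8)) ×ˢ range (n - 3)).filter fun p => pat p.1 (p.2 % 8))

/-- The cell of an index. [folklore] -/
def cellOf (q : Bool × Fin 8 × ℕ) : DihedralGroup n × DihedralGroup n × DihedralGroup n := cell q.1 q.2.1 (q.2.2 : ZMod n)

/-- Unpacking membership in the index set. [folklore] -/
theorem mem_idx {q : Bool × Fin 8 × ℕ} (hq : q ∈ idx n) : q.2.2 < n - 3 ∧ pat q.2.1 (q.2.2 % 8) = true := by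
  simp only [idx, mem_product, mem_univ, true_and, mem_filter, mem_range] at hq
  exact hq

/-- **Core lemma**: two indexed cells with trivial word are the same index (hence the same cell). [folklore] -/
theorem eq_of_cellWord_eq_one (hn : 35 ≤ n) {q q' : Bool × Fin 8 × ℕ} (hq : q ∈ idx n) (hq' : q' ∈ idx n)
    (h : cellWord (cellOf (n := n) q) (cellOf q') = 1) : q = q' := by
  obtain ⟨b, c, i⟩ := q
  obtain ⟨b', c', i'⟩ := q'
  have hi : i < n - 3 := (mem_idx hq).1
  have hpi : pat c (i % 8) = true := (mem_idx hq).2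
  have hi' : i' < n - 3 := (mem_idx hq').1
  have hpi' : pat c' (i' % 8) = true := (mem_idx hq').2
  have h' : cellWord (cell b c (i : ZMod n)) (cell b' c' (i' : ZMod n)) = 1 := h
  clear h
  rw [cellWord_cell_eq_one] at h'
  obtain ⟨hρ, hlin⟩ := h'
  obtain ⟨hα, hk⟩ := WT_shape b b' c c' hρ
  have hint := int_eq_of_zmod_eq (n := n) hα hk (by omega) (by omega) hlin
  -- the forced difference
  have hdiff : (i : ℤ) - i' = fd b c b' c' := by
    unfold fd
    rcases hα with e | e <;> rw [e] at hint ⊢ <;> linarith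
  -- residues mod 8
  have hmod : (((i % 8 : ℕ) : ℤ) - ((i' % 8 : ℕ) : ℤ) - fd b c b' c') % 8 = 0 := by omega
  have := pattern_check b b' c c' ⟨i % 8, Nat.mod_lt _ (by norm_num)⟩ ⟨i' % 8, Nat.mod_lt _ (by norm_num)⟩ hρ hpi hpi'
    hmod
  obtain ⟨hb, hc, hf⟩ := this
  subst hb; subst hc
  rw [hf] at hdiff
  have : i = i' := by omega
  subst this
  rfl

/-- The cell set of the construction. [folklore] -/
def cells (n : ℕ) : Finset (DihedralGroup n × DihedralGroup n × DihedralGroup n) := (idx n).image cellOf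

/-- Distinct indices give distinct cells (injectivity follows from the core lemma and `cellWord P P = 1`). [folklore] -/
theorem card_cells (hn : 35 ≤ n) : #(cells n) = #(idx n) :=
  card_image_of_injOn fun q hq q' hq' e =>
    eq_of_cellWord_eq_one hn (mem_coe.1 hq) (mem_coe.1 hq') (by rw [e]; exact cellWord_self _)

/-- The cells lie in the box `G × {1, r, s} × {1, r², s}`. [folklore] -/
theorem cells_subset_box [NeZero n] : cells n ⊆ univ ×ˢ (({r 0, r 1, sr 0} : Finset (DihedralGroup n)) ×ˢ ({r 0, r 2, sr 0} : Finset _)) := by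
  intro P hP
  obtain ⟨⟨b, c, i⟩, -, rfl⟩ := mem_image.1 hP
  simp only [cellOf, cell, mem_product, mem_univ, true_and, mem_insert, mem_singleton]
  fin_cases c <;> simp [yOf, wOf]

/-- **Independence** of the constructed cell set (`n ≥ 35`). [folklore] -/
theorem cells_indep (hn : 35 ≤ n) :
    ∀ P ∈ cells n, ∀ P' ∈ cells n, P ≠ P' → cellWord P P' ≠ 1 := by
  intro P hP P' hP' hne h1
  obtain ⟨q, hq, rfl⟩ := mem_image.1 hP
  obtain ⟨q', hq', rfl⟩ := mem_image.1 hP'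
  exact hne (by rw [eq_of_cellWord_eq_one hn hq hq' h1])

/-! ### Counting: `#cells ≥ 4n − 14` -/

/-- Number of columns occupied at residue `m`. [folklore] -/
def g (m : ℕ) : ℕ := ∑ c : Fin 8, if pat c m then 1 else 0

/-- Over any `8` consecutive residues the pattern carries `16` cells (density `2`). [folklore] -/
theorem g_period : ∀ u : Fin 8, ∑ j ∈ range 8, g ((u.val + j) % 8) = 16 := by decide

/-- Prefix counts of the pattern: `2t − 1 ≤ Σ_{j<t} g j` for `t < 8`. [folklore] -/
theorem g_prefix : ∀ t : Fin 8, 2 * t.val ≤ (∑ j ∈ range t.val, g j) + 1 := by decide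

/-- The pattern occupies at least `2L − 1` (column, exponent) pairs below `L`. [folklore] -/
theorem sum_g_ge (L : ℕ) : 2 * L ≤ (∑ i ∈ range L, g (i % 8)) + 1 := by
  refine Nat.strong_induction_on L ?_
  intro L ih
  rcases lt_or_ge L 8 with hL | hL
  · have hp : 2 * L ≤ (∑ j ∈ range L, g j) + 1 := g_prefix ⟨L, hL⟩
    have e : ∑ i ∈ range L, g (i % 8) = ∑ j ∈ range L, g j :=
      sum_congr rfl fun j hj => by rw [Nat.mod_eq_of_lt (lt_trans (mem_range.1 hj) hL)]
    rw [e]; exact hp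
  · obtain ⟨L', rfl⟩ : ∃ L', L = L' + 8 := ⟨L - 8, by omega⟩
    rw [sum_range_add]
    have h1 := ih L' (by omega)
    have hp : ∑ j ∈ range 8, g ((L' % 8 + j) % 8) = 16 := g_period ⟨L' % 8, Nat.mod_lt _ (by norm_num)⟩
    have h2 : ∑ j ∈ range 8, g ((L' + j) % 8) = 16 := by
      rw [← hp]
      exact sum_congr rfl fun j _ => congrArg g (by omega)
    omega

/-- The index set counts twice (two fibres) the occupied (column, exponent) pairs. [folklore] -/
theorem card_idx (n : ℕ) : #(idx n) = 2 * ∑ i ∈ range (n - 3), g (i % 8) := by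
  rw [idx, card_product, card_univ, Fintype.card_bool]
  congr 1
  rw [card_eq_sum_ones, sum_filter, sum_product_right]
  refine sum_congr rfl fun i _ => ?_
  rw [g]

/-- **Count**: at least `4n − 14` cells. [folklore] -/
theorem card_cells_ge (hn : 35 ≤ n) : 4 * n ≤ #(cells n) + 14 := by
  rw [card_cells hn, card_idx]
  have := sum_g_ge (n - 3)
  omega

/-! ### The theorems -/

/-- **For every `n ≥ 35`, `DihedralGroup n` (order `2n`) is NOT box-useful**: the truncated 8-periodic construction gives a
`3 × 3` box with at least `4n − 14 ≥ (9/5)·2n` independent cells. [folklore] -/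
theorem not_boxUseful_dihedral_of_le [NeZero n] (hn : 35 ≤ n) : ¬ BoxUseful (DihedralGroup n) := by
  have hcast : ∀ a : ℕ, 0 < a → a < n → ((a : ℕ) : ZMod n) ≠ 0 := fun a ha han e =>
    absurd (Nat.le_of_dvd ha ((ZMod.natCast_eq_zero_iff a n).1 e)) (by omega)
  have h01 : (1 : DihedralGroup n) ≠ r 1 := by
    rw [one_def]; intro e; rw [r.injEq] at e
    exact hcast 1 (by norm_num) (by omega) (by exact_mod_cast e.symm)
  have h02 : (1 : DihedralGroup n) ≠ r 2 := by
    rw [one_def]; intro e; rw [r.injEq] at e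
    exact hcast 2 (by norm_num) (by omega) (by exact_mod_cast e.symm)
  have h1s : (1 : DihedralGroup n) ≠ sr 0 := by
    rw [one_def]; intro e; cases e
  have hY : #({r 0, r 1, sr 0} : Finset (DihedralGroup n)) = 3 := by
    rw [card_insert_of_notMem (by simp [h01, h1s]), card_insert_of_notMem (by simp), card_singleton]
  have hW : #({r 0, r 2, sr 0} : Finset (DihedralGroup n)) = 3 := by
    rw [card_insert_of_notMem (by simp [h02, h1s]), card_insert_of_notMem (by simp), card_singleton]
  refine not_boxUseful_of_indep hY hW (cells_subset_box (n := n)) (cells_indep hn) ?_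
  rw [DihedralGroup.card]
  have := card_cells_ge hn
  omega

end DihedralUniform


end Summit.MatrixMultiplication.OmegaCensus
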